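import Summits.NavierStokesRegularity.NavierStokesRegularity.Theses.AxisymmetricExtremality
import Summits.NavierStokesRegularity.NavierStokesRegularity.Theorems.AxisymmetricExtremalityAxisymmetricKatoGlobalStubSeregin2020TypeIILemma22DeGiorgiIsoperimetric
import Literature.Analysis.FluidPDE.SqIntegralBalance
import HarnessLib

/-!
# Seregin 2020, Lemma 2.2 (after Nazarov–Uraltseva 2012), piece E2:
# De Giorgi's isoperimetric inequality on balls of `ℝ³` for functions smooth off the axis

Helper toward the stub `stub_seregin2020TypeII` of the crux `AxisymmetricKatoGlobal` (= the named
fact `Literature.Analysis.FluidPDE.Seregin2020_axisymmetricSingularPoint_typeII`, G. Seregin,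
Anal. Math. Phys. 10 (2020) Paper 46 = arXiv:2006.04140, Thm 2.1, now = Lemma 2.2, proved after
Nazarov–Uraltseva, St. Petersburg Math. J. 23 (2012), §3). In the class 𝒱 of Lemma 2.2 the slices
`Φ(t, ·)` are `C¹` only OFF THE AXIS `Γ = {x₀ = x₁ = 0}`, so the level-set inequality of
Nazarov–Uraltseva's Lemma 3.3 is needed for such functions. The sibling
`…Lemma22DeGiorgiIsoperimetric` proves De Giorgi's inequality from an a.e.-segment hypothesis
(`deGiorgi_levelSet_ineq_of_ae_segment`); here we verify that hypothesis for `S = B ∖ Γ`: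

* `planarDet_eq_zero_of_mem_segment_of_cylRadius_eq_zero` — if the segment `[x, y]` meets the
  axis then the horizontal parts are linearly dependent, `x₀ y₁ - x₁ y₀ = 0`;
* `volume_setOf_planarDet_eq_zero` — for `x ∉ Γ` the set `{y | x₀ y₁ - x₁ y₀ = 0}` is a proper
  hyperplane, hence Lebesgue-null (`Measure.addHaar_submodule`);
* `ae_prod_planarDet_ne_zero` — consequently `x₀ y₁ - x₁ y₀ ≠ 0` for `vol ⊗ vol`-a.e. pair
  (Tonelli; the axis itself is null, `volume_setOf_cylRadius_eq_zero`), i.e. a.e. segment misses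
  the axis;
* `deGiorgi_isoperimetric_ball_offAxis` — **the inequality**: for `w ∈ C¹(B(x₀, R) ∖ Γ)` and
  `k < l`,
  `(l - k) · |B ∩ {w ≤ k}| · |B ∩ {l ≤ w}| ≤ (64π/3) R⁴ ∫_{B ∩ {k < w < l}} ‖Dw‖`
  (level sets taken in the whole ball — they differ from those in `B ∖ Γ` by null sets);
* `deGiorgi_isoperimetric_ball_offAxis_real` — the same with real volumes and a Bochner integral,
  when `Dw ∈ L¹(B ∩ {k < w < l})`.

## References

* L. A. Caffarelli, A. F. Vasseur, DCDS-S 3 (2010) 409–427, Lemma 1.4 (De Giorgi's isoperimetric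
  inequality). [CaffarelliVasseur2010DeGiorgiSurvey]
* A. I. Nazarov, N. N. Uraltseva, St. Petersburg Math. J. 23 (2012) 93–115 = arXiv:1011.1888,
  §3, proof of Lemma 3.3; Remark 9 and Lemma 4.2 for the axis. [NazarovUraltseva2012]
* G. Seregin, Anal. Math. Phys. 10 (2020), Paper 46 = arXiv:2006.04140, Lemma 2.2. [Seregin2020]
-/

-- the problem directory repeats the summit name (D-0017); core's `dupNamespace` linter fires
set_option linter.dupNamespace false

noncomputable section

open MeasureTheory Set Function Filter Topology Metric Module
open scoped NNReal ENNReal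

namespace Summit.NavierStokesRegularity.NavierStokesRegularity.Theorems.AxisymmetricKatoGlobal.EulerScaling

open Literature.Analysis.FluidPDE

/-! ### Segments meeting the axis form a null set of pairs -/

/-- If a point of the segment `[x, y] ⊆ ℝ³` lies on the axis `{x₀ = x₁ = 0}`, then the horizontal
parts `x' = (x₀, x₁)`, `y' = (y₀, y₁)` are linearly dependent: `x₀ y₁ - x₁ y₀ = 0` (from
`a x' + b y' = 0`, `a + b = 1`). [folklore] -/
theorem planarDet_eq_zero_of_mem_segment_of_cylRadius_eq_zero {x y p : EuclideanSpace ℝ (Fin 3)}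
    (hp : p ∈ segment ℝ x y) (hp0 : cylRadius p = 0) : x 0 * y 1 - x 1 * y 0 = 0 := by
  obtain ⟨a, b, -, -, hab, rfl⟩ := hp
  obtain ⟨h0, h1⟩ := (cylRadius_eq_zero_iff _).1 hp0
  simp only [PiLp.add_apply, PiLp.smul_apply, smul_eq_mul] at h0 h1
  linear_combination (y 1 - x 1) * h0 + (x 0 - y 0) * h1 - (x 0 * y 1 - x 1 * y 0) * hab

/-- For `x` off the axis, `{y | x₀ y₁ - x₁ y₀ = 0}` is the kernel of the nonzero linear form
`y ↦ x₀ y₁ - x₁ y₀` (its value at `(-x₁, x₀, 0)` is `x₀² + x₁² ≠ 0`), a proper subspace, hence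
Lebesgue-null. [folklore] -/
theorem volume_setOf_planarDet_eq_zero {x : EuclideanSpace ℝ (Fin 3)} (hx : cylRadius x ≠ 0) :
    volume {y : EuclideanSpace ℝ (Fin 3) | x 0 * y 1 - x 1 * y 0 = 0} = 0 := by
  set φ : EuclideanSpace ℝ (Fin 3) →ₗ[ℝ] ℝ :=
    x 0 • (EuclideanSpace.proj (1 : Fin 3) : EuclideanSpace ℝ (Fin 3) →L[ℝ] ℝ).toLinearMap -
      x 1 • (EuclideanSpace.proj (0 : Fin 3) : EuclideanSpace ℝ (Fin 3) →L[ℝ] ℝ).toLinearMap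
    with hφ
  have hφapp : ∀ y, φ y = x 0 * y 1 - x 1 * y 0 := fun y => by
    simp [hφ, EuclideanSpace.proj]
  have hker : LinearMap.ker φ ≠ ⊤ := by
    intro htop
    have hmem : EuclideanSpace.single (1 : Fin 3) (x 0) - EuclideanSpace.single (0 : Fin 3) (x 1) ∈
        LinearMap.ker φ := by
      rw [htop]; trivial
    rw [LinearMap.mem_ker, hφapp] at hmem
    have hval : x 0 ^ 2 + x 1 ^ 2 = 0 := by
      simp at hmem
      nlinarith [hmem]
    rw [← cylRadius_sq] at hval
    exact hx (pow_eq_zero_iff two_ne_zero |>.1 hval)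
  refine measure_mono_null (fun y hy => ?_) (Measure.addHaar_submodule volume _ hker)
  rw [SetLike.mem_coe, LinearMap.mem_ker, hφapp]
  exact hy

/-- **A.e. segment misses the axis.** For `vol ⊗ vol`-a.e. pair `(x, y)` of points of `ℝ³`,
`x₀ y₁ - x₁ y₀ ≠ 0` (Tonelli: the axis is null, and for `x` off the axis the exceptional `y` form
a null hyperplane); by `planarDet_eq_zero_of_mem_segment_of_cylRadius_eq_zero` the segment
`[x, y]` then avoids the axis. [folklore] -/
theorem ae_prod_planarDet_ne_zero :
    ∀ᵐ z : EuclideanSpace ℝ (Fin 3) × EuclideanSpace ℝ (Fin 3) ∂(volume.prod volume),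
      z.1 0 * z.2 1 - z.1 1 * z.2 0 ≠ 0 := by
  have hc : Continuous fun z : EuclideanSpace ℝ (Fin 3) × EuclideanSpace ℝ (Fin 3) =>
      z.1 0 * z.2 1 - z.1 1 * z.2 0 := by fun_prop
  have hmeas : MeasurableSet {z : EuclideanSpace ℝ (Fin 3) × EuclideanSpace ℝ (Fin 3) |
      z.1 0 * z.2 1 - z.1 1 * z.2 0 = 0} := measurableSet_eq_fun hc.measurable measurable_const
  rw [ae_iff]
  simp only [not_not]
  rw [Measure.prod_apply hmeas]
  refine (lintegral_congr_ae ?_).trans lintegral_zero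
  have hax : ∀ᵐ x : EuclideanSpace ℝ (Fin 3) ∂volume, cylRadius x ≠ 0 := by
    rw [ae_iff]; simp only [not_not]; exact volume_setOf_cylRadius_eq_zero
  filter_upwards [hax] with x hx
  exact volume_setOf_planarDet_eq_zero hx

/-! ### De Giorgi's inequality for functions `C¹` off the axis -/

/-- **De Giorgi's isoperimetric inequality on balls of `ℝ³` for functions `C¹` off the axis**
(the form needed in the class 𝒱 of Seregin 2020, Lemma 2.2 / Nazarov–Uraltseva 2012, Lemma 3.3
with Remark 9). For `w ∈ C¹(B(x₀, R) ∖ Γ)`, `Γ = {x₀ = x₁ = 0}` the axis, and levels `k < l`: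
`(l - k) · |B ∩ {w ≤ k}| · |B ∩ {l ≤ w}| ≤ (64π/3) R⁴ ∫_{B ∩ {k < w < l}} ‖Dw‖`.
Proof: `deGiorgi_levelSet_ineq_of_ae_segment` with `S = B ∖ Γ`, `A₀ = S ∩ {w ≤ k}`,
`A₁ = S ∩ {l ≤ w}` (a.e. segment misses `Γ`, `ae_prod_planarDet_ne_zero`), and `|Γ| = 0`.
[cite: CaffarelliVasseur2010DeGiorgiSurvey, Lemma 1.4] -/
theorem deGiorgi_isoperimetric_ball_offAxis :
    ∀ (w : EuclideanSpace ℝ (Fin 3) → ℝ) (x₀ : EuclideanSpace ℝ (Fin 3)) (R k l : ℝ),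
      ContDiffOn ℝ 1 w (ball x₀ R ∩ {x | cylRadius x ≠ 0}) → k < l →
      ENNReal.ofReal (l - k) * volume (ball x₀ R ∩ {x | w x ≤ k}) *
          volume (ball x₀ R ∩ {x | l ≤ w x}) ≤
        ENNReal.ofReal (64 * Real.pi / 3 * R ^ 4) *
          ∫⁻ x in ball x₀ R ∩ {x | k < w x ∧ w x < l}, ‖fderiv ℝ w x‖ₑ := by
  intro w x₀ R k l hw hkl
  rcases le_or_gt R 0 with hR | hR
  · simp [Metric.ball_eq_empty.2 hR]
  set S : Set (EuclideanSpace ℝ (Fin 3)) := ball x₀ R ∩ {x | cylRadius x ≠ 0} with hS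
  have hSo : IsOpen S := isOpen_ball.inter (isOpen_ne_fun continuous_cylRadius continuous_const)
  set A₀ : Set (EuclideanSpace ℝ (Fin 3)) := S ∩ {x | w x ≤ k} with hA₀
  set A₁ : Set (EuclideanSpace ℝ (Fin 3)) := S ∩ {x | l ≤ w x} with hA₁
  have hA₀m : MeasurableSet A₀ :=
    measurableSet_inter_setOf_le_of_continuousOn hSo hw.continuousOn k
  have hA₁m : MeasurableSet A₁ :=
    measurableSet_inter_setOf_ge_of_continuousOn hSo hw.continuousOn l
  -- the axis is null: the level sets in `B` and in `S = B ∖ Γ` have the same measure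
  have hnull : volume {x : EuclideanSpace ℝ (Fin 3) | cylRadius x = 0} = 0 :=
    volume_setOf_cylRadius_eq_zero
  have hlevel : ∀ (P : EuclideanSpace ℝ (Fin 3) → Prop),
      volume (ball x₀ R ∩ {x | P x}) ≤ volume (S ∩ {x | P x}) := by
    intro P
    calc volume (ball x₀ R ∩ {x | P x})
        ≤ volume (S ∩ {x | P x} ∪ {x | cylRadius x = 0}) := by
          refine measure_mono fun x hx => ?_
          by_cases h : cylRadius x = 0
          · exact Or.inr h
          · exact Or.inl ⟨⟨hx.1, h⟩, hx.2⟩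
      _ ≤ volume (S ∩ {x | P x}) + volume {x : EuclideanSpace ℝ (Fin 3) | cylRadius x = 0} :=
          measure_union_le _ _
      _ = volume (S ∩ {x | P x}) := by rw [hnull, add_zero]
  -- a.e. pair of `A₀ × A₁` is joined by a segment inside `S`
  have hseg : ∀ᵐ z ∂(volume.restrict A₀).prod (volume.restrict A₁),
      z ∈ A₀ ×ˢ A₁ → segment ℝ z.1 z.2 ⊆ S := by
    have hle : (volume.restrict A₀).prod (volume.restrict A₁) ≤
        (volume : Measure (EuclideanSpace ℝ (Fin 3))).prod volume := by
      rw [Measure.prod_restrict]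
      exact Measure.restrict_le_self
    filter_upwards [ae_prod_planarDet_ne_zero.filter_mono (ae_mono hle)] with z hz hzA p hp
    refine ⟨(convex_ball x₀ R).segment_subset hzA.1.1.1 hzA.2.1.1 hp, fun hp0 => hz ?_⟩
    exact planarDet_eq_zero_of_mem_segment_of_cylRadius_eq_zero hp hp0
  have hcore := deGiorgi_levelSet_ineq_of_ae_segment volume hSo hw (x₀ := x₀) (R := R) hkl hA₀m
    hA₁m (fun x hx => ⟨hx.1.1, hx.2⟩) (fun x hx => ⟨hx.1.1, hx.2⟩) hseg
  calc ENNReal.ofReal (l - k) * volume (ball x₀ R ∩ {x | w x ≤ k}) *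
        volume (ball x₀ R ∩ {x | l ≤ w x})
      ≤ ENNReal.ofReal (l - k) * volume A₀ * volume A₁ :=
        mul_le_mul' (mul_le_mul' le_rfl (hlevel fun x => w x ≤ k)) (hlevel fun x => l ≤ w x)
    _ ≤ _ := hcore
    _ ≤ ENNReal.ofReal (64 * Real.pi / 3 * R ^ 4) *
          ∫⁻ x in ball x₀ R ∩ {x | k < w x ∧ w x < l}, ‖fderiv ℝ w x‖ₑ := by
        rw [finrank_euclideanSpace_fin, ← ofReal_deGiorgiConst_fin_three hR.le x₀]
        gcongr 1
        exact lintegral_mono_set fun x hx => ⟨hx.1.1, hx.2⟩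

/-- **De Giorgi's isoperimetric inequality off the axis, real-valued form.** Under the hypotheses
of `deGiorgi_isoperimetric_ball_offAxis` and `Dw ∈ L¹(B ∩ {k < w < l})`:
`(l - k) · |B ∩ {w ≤ k}| · |B ∩ {l ≤ w}| ≤ (64π/3) R⁴ ∫_{B ∩ {k < w < l}} ‖Dw‖ dx` with real
volumes (`ENNReal.toReal`) and a Bochner integral. [cite: CaffarelliVasseur2010DeGiorgiSurvey, Lemma 1.4] -/
theorem deGiorgi_isoperimetric_ball_offAxis_real :
    ∀ (w : EuclideanSpace ℝ (Fin 3) → ℝ) (x₀ : EuclideanSpace ℝ (Fin 3)) (R k l : ℝ),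
      ContDiffOn ℝ 1 w (ball x₀ R ∩ {x | cylRadius x ≠ 0}) → k < l →
      IntegrableOn (fun x => fderiv ℝ w x) (ball x₀ R ∩ {x | k < w x ∧ w x < l}) volume →
      (l - k) * (volume (ball x₀ R ∩ {x | w x ≤ k})).toReal *
          (volume (ball x₀ R ∩ {x | l ≤ w x})).toReal ≤
        64 * Real.pi / 3 * R ^ 4 * ∫ x in ball x₀ R ∩ {x | k < w x ∧ w x < l}, ‖fderiv ℝ w x‖ := by
  intro w x₀ R k l hw hkl hint
  have h := deGiorgi_isoperimetric_ball_offAxis w x₀ R k l hw hkl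
  have hfin : ENNReal.ofReal (64 * Real.pi / 3 * R ^ 4) *
      ∫⁻ x in ball x₀ R ∩ {x | k < w x ∧ w x < l}, ‖fderiv ℝ w x‖ₑ ≠ ∞ :=
    ENNReal.mul_ne_top ENNReal.ofReal_ne_top
      (hasFiniteIntegral_iff_enorm.1 hint.hasFiniteIntegral).ne
  have h' := ENNReal.toReal_mono hfin h
  have hC : (0 : ℝ) ≤ 64 * Real.pi / 3 * R ^ 4 := by positivity
  simp only [ENNReal.toReal_mul, ENNReal.toReal_ofReal (sub_nonneg.2 hkl.le),
    ENNReal.toReal_ofReal hC] at h'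
  rwa [← integral_norm_eq_lintegral_enorm hint.aestronglyMeasurable] at h'

end Summit.NavierStokesRegularity.NavierStokesRegularity.Theorems.AxisymmetricKatoGlobal.EulerScaling
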